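import Literature.MathematicalPhysics.QuantumFieldTheory.BalabanImbrieJaffe1984to88.BIJ88Sect5StatementsPart3

/-!
# `BalabanImbrieJaffe1984to88.BIJ88Transl552Axial` — T. Bałaban, J. Imbrie, A. Jaffe, *Effective action and cluster properties of
the abelian Higgs model*, Commun. Math. Phys. **114** (1988) 257–315 [BalabanImbrieJaffe1988], Sect. 5.5 p. 284 [PDF 28], the
sentence after (5.5.2), verbatim: *"Our construction of a C^{(k)}_{loc} satisfying (2.10), (2.11) ensures that δ_{Ax}(A′) =
δ_{Ax}(A^{(k)}), δ(QA′) = δ(QA^{(k)})."* — THE AXIAL-GAUGE HALF `δ_{Ax}(A′) = δ_{Ax}(A^{(k)})`, PROVED over the typed carriers of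
r16's `BIJ88Sect5StatementsPart3.transl552` ((5.5.2) `A′ = A^{(k)} − L^{−2}Λ₄^{(k)*}C^{(k)}_{loc}H*_{k,loc}∂*Q^{e*}_{k+1}f`, printed
operator order) and of the G-C2-08 repaired order (cut-off inside the localized covariance, `Q_transl552_inside`).

statement-level skeleton of published theorems with citation tags; proofs where landed; nothing here is a claim about the Yang–Mills mass gap

THE MECHANISM (the print's «(2.10), (2.11)»: the localized covariance maps into axial-gauge fields).  `δ_{Ax}` is the δ-function of
the axial subspace `ℋ_{Ax} = {A : A(b) = 0 for the axial bonds b}` ([BalabanJaffe1986] (2.11)–(2.12), r20's `BJ86AxialSubspace212`; here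
an arbitrary submodule `H`).  The translation (5.5.2) changes `A^{(k)}` by `L^{−2}Λ₄^{(k)*}C^{(k)}_{loc}(…)`; if `C^{(k)}_{loc}` maps INTO
`H` (hypothesis `hC` — the located content of «satisfying (2.10), (2.11)», row C2.Eq2.10/2.11 of the C2 part-1 file) and the cut-off
`Λ₄^{(k)*}` preserves `H` (hypothesis `hΛ`; for `H = ℋ_{Ax}` and `Λ₄^{(k)*}` = multiplication by the indicator of a bond set this is
automatic, `mulIndicator_mem_vanishing`), then `A′ − A^{(k)} ∈ H`, hence `A′ ∈ H ↔ A^{(k)} ∈ H` and the two δ-functions agree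
(`deltaH_transl552`).  Both operator orders are covered (printed: `transl552`; repaired: `A − L⁻²C_{loc}(Λ₄(…))`, where `hΛ` is not
even needed).  The `Q`-half of the sentence is r16's `Q_transl552`/`Q_transl552_inside` (+ p31's `BIJ88Eq552CutoffWitness/Locus`,
GAPS G-C2-08) and is not restated.

CITATION HEADER (lean-in-tree rule).  Part of the lit-balaban TYPED SKELETON (HOME `run/shared/lean/pub/lit-balaban/`), reader/typer
block r16 (unit `lit-balaban-r16`, gen 8; own Lean lane, free-target protocol G.5-34(d)); SKELETON row **C2.Eq5.5.1-5.5.12** (fold owner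
r16, `HOME/lit-balaban-r16/ROWS-C2-part2.md`), member «δ_{Ax}(A′) = δ_{Ax}(A^{(k)})» — the one printed claim of the row that the
owner's display audit (v2.54/v2.55) found without a theorem (p34 g9's measure-level `BIJ88RT552Transl` takes it as hypothesis (A)).
WHAT IS PROVED (theorems only; no definition, no named fact; Mathlib + r16's Part3 only):
* `sub_transl552_eq` (the shift `A − A′ = L⁻²Λ₄(C_{loc}(H*(Xf)))`), **`transl552_sub_mem`** / **`transl552_mem_iff`** (printed order),
  `translInside_mem_iff` (repaired order), **`deltaH_transl552`** / `deltaH_translInside` (the δ-functions — indicators of `H` — agree),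
  `mulIndicator_mem_vanishing` (on bond functions `β → ℝ`: multiplication by any function preserves the subspace of functions vanishing
  on a bond set — discharges `hΛ` for the cut-off `Λ₄^{(k)*}`), `transl552_mem_vanishing_iff` (the bond-function instance: `C_{loc}`
  mapping into the fields vanishing on the axial bonds ⟹ `A′` vanishes on them iff `A^{(k)}` does).
HONEST SCOPE.  The content of «(2.10), (2.11)» used here is exactly `hC` (range of `C^{(k)}_{loc}` inside the axial subspace); it is a
hypothesis, discharged nowhere in this file (part-1 rows).  Nothing about measures: the measure-level use (invariance of `∫𝒟u δ_{Ax}(u)`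
under the multiplicative shift) is p34's `BIJ88RT552Transl`.  Unit `lit-balaban-r16` (literature-prover-lit-balaban-r16-g8-0), 2026-08-21.
NOT summit progress.
-/

namespace Literature.MathematicalPhysics.QuantumFieldTheory.BalabanImbrieJaffe1984to88.BIJ88Transl552Axial

open BIJ88Sect5StatementsPart3 (transl552)

section Abstract

variable {M : Type*} [AddCommGroup M] [Module ℝ M]

/-- the shift of (5.5.2): `A^{(k)} − A′ = L⁻²Λ₄^{(k)*}C^{(k)}_{loc}H*_{k,loc}∂*Q^{e*}_{k+1}f`. [cite: BalabanImbrieJaffe1988, (5.5.2) p.283] -/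
theorem sub_transl552_eq (L : ℝ) (Λ4 Cloc Hsloc X : Module.End ℝ M) (A f : M) :
    A - transl552 L Λ4 Cloc Hsloc X A f = L⁻¹ ^ 2 • Λ4 (Cloc (Hsloc (X f))) := by
  simp [transl552]

/-- **«δ_{Ax}(A′) = δ_{Ax}(A^{(k)})», the mechanism**: if `C^{(k)}_{loc}` maps into the (axial) subspace `H` («satisfying (2.10),
(2.11)») and the cut-off `Λ₄^{(k)*}` preserves `H`, then `A^{(k)} − A′ ∈ H`. [cite: BalabanImbrieJaffe1988, (5.5.2) p.283–284] -/
theorem transl552_sub_mem (H : Submodule ℝ M) (L : ℝ) {Λ4 Cloc : Module.End ℝ M} (hC : ∀ x, Cloc x ∈ H)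
    (hΛ : ∀ y ∈ H, Λ4 y ∈ H) (Hsloc X : Module.End ℝ M) (A f : M) :
    A - transl552 L Λ4 Cloc Hsloc X A f ∈ H := by
  rw [sub_transl552_eq]
  exact H.smul_mem _ (hΛ _ (hC _))

/-- **«δ_{Ax}(A′) = δ_{Ax}(A^{(k)})»** as membership: `A′ ∈ H ↔ A^{(k)} ∈ H` (printed operator order of (5.5.2)).
[cite: BalabanImbrieJaffe1988, (5.5.2) p.283–284] -/
theorem transl552_mem_iff (H : Submodule ℝ M) (L : ℝ) {Λ4 Cloc : Module.End ℝ M} (hC : ∀ x, Cloc x ∈ H)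
    (hΛ : ∀ y ∈ H, Λ4 y ∈ H) (Hsloc X : Module.End ℝ M) (A f : M) :
    transl552 L Λ4 Cloc Hsloc X A f ∈ H ↔ A ∈ H := by
  have h := transl552_sub_mem H L hC hΛ Hsloc X A f
  constructor
  · intro hA'
    simpa using H.add_mem h hA'
  · intro hA
    simpa using H.sub_mem hA h

/-- the same for the G-C2-08 REPAIRED operator order `A″ = A^{(k)} − L⁻²C^{(k)}_{loc}Λ₄^{(k)*}H*_{k,loc}∂*Q^{e*}_{k+1}f` (cut-off inside the
localized covariance, cf. `Q_transl552_inside`): here only `hC` is needed. [cite: BalabanImbrieJaffe1988, (5.5.2) p.283–284] -/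
theorem translInside_mem_iff (H : Submodule ℝ M) (L : ℝ) {Cloc : Module.End ℝ M} (hC : ∀ x, Cloc x ∈ H)
    (Λ4 Hsloc X : Module.End ℝ M) (A f : M) :
    A - L⁻¹ ^ 2 • Cloc (Λ4 (Hsloc (X f))) ∈ H ↔ A ∈ H := by
  have h : L⁻¹ ^ 2 • Cloc (Λ4 (Hsloc (X f))) ∈ H := H.smul_mem _ (hC _)
  constructor
  · intro hA'
    simpa using H.add_mem hA' h
  · intro hA
    exact H.sub_mem hA h

open Classical in
/-- **«δ_{Ax}(A′) = δ_{Ax}(A^{(k)})» as printed**: the δ-function of the axial subspace (its indicator) takes the same value at `A′` and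
at `A^{(k)}`. [cite: BalabanImbrieJaffe1988, (5.5.2) p.283–284] -/
theorem deltaH_transl552 (H : Submodule ℝ M) (L : ℝ) {Λ4 Cloc : Module.End ℝ M} (hC : ∀ x, Cloc x ∈ H)
    (hΛ : ∀ y ∈ H, Λ4 y ∈ H) (Hsloc X : Module.End ℝ M) (A f : M) :
    (H : Set M).indicator (fun _ => (1 : ℝ)) (transl552 L Λ4 Cloc Hsloc X A f) = (H : Set M).indicator (fun _ => (1 : ℝ)) A := by
  by_cases hA : A ∈ H
  · rw [Set.indicator_of_mem (show transl552 L Λ4 Cloc Hsloc X A f ∈ (H : Set M) from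
      (transl552_mem_iff H L hC hΛ Hsloc X A f).2 hA), Set.indicator_of_mem (show A ∈ (H : Set M) from hA)]
  · rw [Set.indicator_of_notMem (show transl552 L Λ4 Cloc Hsloc X A f ∉ (H : Set M) from
      fun h => hA ((transl552_mem_iff H L hC hΛ Hsloc X A f).1 h)), Set.indicator_of_notMem (show A ∉ (H : Set M) from hA)]

open Classical in
/-- the δ-functions agree for the repaired order as well. [cite: BalabanImbrieJaffe1988, (5.5.2) p.283–284] -/
theorem deltaH_translInside (H : Submodule ℝ M) (L : ℝ) {Cloc : Module.End ℝ M} (hC : ∀ x, Cloc x ∈ H)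
    (Λ4 Hsloc X : Module.End ℝ M) (A f : M) :
    (H : Set M).indicator (fun _ => (1 : ℝ)) (A - L⁻¹ ^ 2 • Cloc (Λ4 (Hsloc (X f)))) =
      (H : Set M).indicator (fun _ => (1 : ℝ)) A := by
  by_cases hA : A ∈ H
  · rw [Set.indicator_of_mem (show A - L⁻¹ ^ 2 • Cloc (Λ4 (Hsloc (X f))) ∈ (H : Set M) from
      (translInside_mem_iff H L hC Λ4 Hsloc X A f).2 hA), Set.indicator_of_mem (show A ∈ (H : Set M) from hA)]
  · rw [Set.indicator_of_notMem (show A - L⁻¹ ^ 2 • Cloc (Λ4 (Hsloc (X f))) ∉ (H : Set M) from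
      fun h => hA ((translInside_mem_iff H L hC Λ4 Hsloc X A f).1 h)), Set.indicator_of_notMem (show A ∉ (H : Set M) from hA)]

end Abstract

/-! ## The bond-function instance: `ℋ_{Ax}` = fields vanishing on the axial bonds; the cut-off is a multiplication -/

section Bonds

variable {β : Type*}

/-- the axial subspace of bond functions vanishing on a set `Ax` of bonds ([BalabanJaffe1986] (2.12) shape, as a submodule of `β → ℝ`).
[cite: BalabanImbrieJaffe1988, (5.5.2) p.283–284] -/
theorem mem_vanishing_iff (Ax : Set β) (A : β → ℝ) :
    A ∈ (⨅ b ∈ Ax, LinearMap.ker (LinearMap.proj b : (β → ℝ) →ₗ[ℝ] ℝ)) ↔ ∀ b ∈ Ax, A b = 0 := by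
  simp [Submodule.mem_iInf]

/-- the cut-off `Λ₄^{(k)*}` — multiplication by a fixed bond function `χ` (an indicator) — preserves the subspace of fields vanishing on
`Ax`: the hypothesis `hΛ` of `transl552_mem_iff` holds automatically on bond functions. [cite: BalabanImbrieJaffe1988, (5.5.2) p.283–284] -/
theorem mulIndicator_mem_vanishing (Ax : Set β) (χ : β → ℝ) {A : β → ℝ}
    (hA : A ∈ (⨅ b ∈ Ax, LinearMap.ker (LinearMap.proj b : (β → ℝ) →ₗ[ℝ] ℝ))) :
    (LinearMap.pi fun b => (χ b) • (LinearMap.proj b : (β → ℝ) →ₗ[ℝ] ℝ)) A ∈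
      (⨅ b ∈ Ax, LinearMap.ker (LinearMap.proj b : (β → ℝ) →ₗ[ℝ] ℝ)) := by
  rw [mem_vanishing_iff] at hA ⊢
  intro b hb
  simp [hA b hb]

/-- **«δ_{Ax}(A′) = δ_{Ax}(A^{(k)})» ON BOND FUNCTIONS**: with the cut-off `Λ₄^{(k)*}` = multiplication by `χ` and a localized covariance
`C^{(k)}_{loc}` whose range vanishes on the axial bonds `Ax` («satisfying (2.10), (2.11)», hypothesis `hC`), the translated field
`A′ = transl552 …` vanishes on `Ax` iff `A^{(k)}` does. [cite: BalabanImbrieJaffe1988, (5.5.2) p.283–284] -/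
theorem transl552_mem_vanishing_iff (Ax : Set β) (χ : β → ℝ) (L : ℝ) {Cloc : Module.End ℝ (β → ℝ)}
    (hC : ∀ x, ∀ b ∈ Ax, Cloc x b = 0) (Hsloc X : Module.End ℝ (β → ℝ)) (A f : β → ℝ) :
    (∀ b ∈ Ax, transl552 L (LinearMap.pi fun b => (χ b) • (LinearMap.proj b : (β → ℝ) →ₗ[ℝ] ℝ)) Cloc Hsloc X A f b = 0) ↔
      ∀ b ∈ Ax, A b = 0 := by
  have hC' : ∀ x, Cloc x ∈ (⨅ b ∈ Ax, LinearMap.ker (LinearMap.proj b : (β → ℝ) →ₗ[ℝ] ℝ)) :=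
    fun x => (mem_vanishing_iff Ax _).2 (hC x)
  have h := transl552_mem_iff (⨅ b ∈ Ax, LinearMap.ker (LinearMap.proj b : (β → ℝ) →ₗ[ℝ] ℝ)) L hC'
    (fun y hy => mulIndicator_mem_vanishing Ax χ hy) Hsloc X A f
  rwa [mem_vanishing_iff, mem_vanishing_iff] at h

end Bonds

end Literature.MathematicalPhysics.QuantumFieldTheory.BalabanImbrieJaffe1984to88.BIJ88Transl552Axial
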